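import Summits.BirchSwinnertonDyer.BirchSwinnertonDyer.Theorems.ClassRecordThreeCornerTwinHalvesDefs
import HarnessLib

/-!
# Routes `ClassRecordThree` ∕ `KolyvaginRoadThree` (rung K2@3), crux `CornerAtThreeW` (item stmt-BirchSwinnertonDyer-21420):
# the TWO-TWIN HALF-SQUEEZE of the (W) conjunct — the consumer REPLAYS (each corner consumer needs only ITS half of the
# twin's rank-0 `BSD₃`, at ITS twin) (cell `bsd-stepL`, seat `bsd-stepL-corner3-p2` g6 = WIDTH-LEVER lane B; prover ticket
# T-g8-1 of crux idea card J, `Cruxes/CornerAtThreeW/Ideas/two-twin-half-squeeze-at-3.md`)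

`--supports stmt-BirchSwinnertonDyer-21420 --as helper`. THEOREMS ONLY (no definition, no named fact, no `sorry`), Theses-free.
Every theorem is CONDITIONAL on its displayed binders — the PUBLISHED named facts of the tree (Gross–Zagier `hGZ`, Kolyvagin
`hKo`, `r = r_an ≤ 1` `hGZK`, modularity `hmod` ∕ `hnf`, Mazur's Manin constant `hMaz`, Poitou–Tate `hPT`, local
Euler–Poincaré `hEP`, Matar–Nekovář `hMN`) and the corner's typed OPEN inputs (L) `X11b.Three.CornerStepLAt W`, (U)
`X11b.Three.CornerUpperAt W`, and the two half-twins F1′ `CornerTwinLowerAt W` ∕ F2′ `CornerTwinUpperAt W` of the Defs module.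

* `missingUpperBoundAt_of_cornerUpperAt_of_twinLower` — upper half of `E` on the Tamagawa cells (`3 ∣ ∏c`) from (U) + F1′:
  replay of `X11b.Three.missingUpperBoundAt_of_cornerUpperAt` at the F1′ twin; the twin's Kato half is NOT used.
* `missingLowerBoundAt_of_cornerStepLAt_of_twinUpper` — lower half of `E` from (L) + F2′: replay of
  `X11b.Three.missingLowerBoundAt_of_cornerStepLAt_of_cornerTwistAt` at the F2′ twin; the twin's main-conjecture half is NOT used.
* `missingPPartAt_of_corner_of_twoTwins` — the squeeze `ord₃ #Ш(E) = ord₃ #Ш(E)_an` on the corner from (L), the (U)-consumer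
  shape on `3 ∣ ∏c`, F1′ and F2′ (on `3 ∤ ∏c` the upper half of `E` is Matar–Nekovář at the F1′ field): replay of
  `X11b.Three.missingPPartAt_of_corner_of_witness` with the witness split into its two halves at two fields.
* `missingUpperBoundAt_of_dvd_of_cornerUpperAt_of_twinLower` — the (U) conjunct feeds the squeeze through the F1′ replay
  (the shape `closes` consumes).
Proofs VERBATIM = the planner's kernel-checked `Sketch.lean` §α (sha16 dd92dcf211d2cdad, evidence #5 on item 21420).

HONEST FRAMING: nothing here is a BSD class theorem; nothing booked; no census word, tier or label moves (T7); item 21420 is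
NOT closed and its (W) conjunct is NOT proved — this file only shows that WEAKER inputs than (W) suffice for both consumers.
BSD is not proved by any of this. The RE-GLUE of `closes` (items `CornerTwinLower` ∕ `CornerTwinUpper` replacing (W)) is a
planner action, not taken here.

References: [JetchevSkinnerWan2017] §7.4.1 (eq:shalowerK-1) and §7.4.2 (eq:shaupper), pp. 30–31; [GrossLMS1991] (2.2);
[MatarNekovar2019] Thm. 0.3, §0.11; [Miller2011LMS] Def. 1.1; [MilneADT2006] I Thm. 4.10(b), Thm. 2.8; card J; cell board T-g8-1.
-/

set_option linter.dupNamespace false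

open scoped Classical

open WeierstrassCurve NumberField IsDedekindDomain Field Literature.NumberTheory.EllipticCurves
  Rat.HeightOneSpectrum
  Literature.NumberTheory.DiophantineGeometry
  Literature.NumberTheory.EllipticCurves.GreenbergSelmer
  Literature.NumberTheory.EllipticCurves.ModularForms
  Literature.NumberTheory.EllipticCurves.Rank1Residual
  Literature.NumberTheory.EllipticCurves.Rank1Residual.Typed
  Literature.NumberTheory.EllipticCurves.Wuthrich2014
  Literature.NumberTheory.EllipticCurves.BalakrishnanEtAl2019
  Literature.NumberTheory.QuadraticFields.Quadratic
  Literature.NumberTheory.Automorphic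
  Literature.NumberTheory.GaloisRepresentations Literature.NumberTheory.GaloisCohomology
  Summit.BirchSwinnertonDyer.Rank1Residual.X11b.AcSelmer
  Summit.BirchSwinnertonDyer.Rank1Residual.X11b.LocBridge
  Summit.BirchSwinnertonDyer.Rank1Residual
  Summit.BirchSwinnertonDyer.Rank1Residual.X11b
  Summit.BirchSwinnertonDyer.Rank1Residual.X11b.Three
  Summit.BirchSwinnertonDyer.BirchSwinnertonDyer.Theorems.CornerTwistWitness

namespace Summit.BirchSwinnertonDyer.BirchSwinnertonDyer.Theorems.CornerTwinHalves

/-! ### The replays: each consumer needs only ITS half, at ITS twin -/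

/-- **Upper half of `E` from (U) + F1′** — replay of `missingUpperBoundAt_of_cornerUpperAt` (carriers `3 ∣ ∏c`) at the
F1′ twin; the twin's Kato half is NOT used. -/
theorem missingUpperBoundAt_of_cornerUpperAt_of_twinLower [Fact (Nat.Prime 3)]
    (hGZ : ∀ (N : ℕ) [NeZero N] (W : WeierstrassCurve ℚ) (K : Type) [Field K] [NumberField K],
      gross_zagier N W K)
    (hKo : ∀ (N : ℕ) [NeZero N] (W : WeierstrassCurve ℚ) (K : Type) [Field K] [NumberField K],
      kolyvagin N W K)
    (hGZK : rank_eq_analyticRank_of_analyticRank_le_one) (hmod : hasEntireLFunction_rat)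
    (hnf : exists_isNewformOf) (hMaz : mazur_not_dvd_maninConstant_of_odd)
    (W : WeierstrassCurve ℚ) [W.IsElliptic] [W.IsGloballyMinimal] (hX : ClassX11b W 3)
    (hns : ¬ Surj W 3) (ht : 3 ∣ W.tamagawaProduct) (hU : CornerUpperAt W) (hF1 : CornerTwinLowerAt W) :
    Typed.MissingUpperBoundAt W 3 := by
  have hNS : integral_neronScaling_of_isGloballyMinimal :=
    integral_neronScaling_of_isGloballyMinimal_holds
  obtain ⟨hr, hp2, hmult, hirr⟩ := id hX
  haveI : NeZero (W.conductorNorm ℤ) := ⟨(W.conductorNorm_pos_holds).ne'⟩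
  obtain ⟨K, _, _, Wd, _, _, Cd, ⟨hK, hodd, hlt, hHN, hH3, hLt, hWd⟩, qd, hqd, hvle⟩ := hF1 hX hns
  have hpd : ¬ (3 : ℤ) ∣ NumberField.discr K := not_dvd_discr_of_split hK Nat.prime_three hp2 hH3
  have hμ : ¬ 3 ∣ Units.torsionOrder K := by
    haveI : IsTotallyComplex K := hK.2
    rw [Literature.NumberTheory.DiophantineGeometry.torsionOrder_eq_two_of_discr_lt hK.1 hlt]
    omega
  obtain ⟨Dt, H, ι, P, hP, hc⟩ :=
    exists_maninDatum_of_odd hnf hMaz hNS W 3 (W.conductorNorm ℤ) K rfl hp2 hmult hirr hK hHN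
  have htam : padicValNat 3 Wd.tamagawaProduct = padicValNat 3 W.tamagawaProduct :=
    X2.padicValNat_tamagawaProduct_twist_of_heegner_of_odd W 3 hp2 K hK hodd hpd hHN Cd hWd
  have hu : padicValRat 3 (Cd.u : ℚ) = 0 :=
    padicValRat_u_eq_zero_of_twist_minimal W 3 K hK hHN hmult Cd hWd
  exact missingUpperBoundAt_of_shaIndexBound_sharp W 3 (W.conductorNorm ℤ) K Dt H ι P (hGZ _ W K)
    (hKo _ W K) hGZK hmod hK hHN hP hp2 hc hμ hr hLt Wd Cd hWd hu htam le_rfl ⟨qd, hqd, hvle⟩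
    (fun hfin hPinf ↦ hU (W.conductorNorm ℤ) K Dt H ι P hX hns ht rfl hK hodd hHN hLt hP hc hPinf hfin)

/-- **Lower half of `E` from (L) + F2′** — replay of `missingLowerBoundAt_of_cornerStepLAt_of_cornerTwistAt` at the F2′
twin; the twin's main-conjecture half is NOT used. -/
theorem missingLowerBoundAt_of_cornerStepLAt_of_twinUpper [Fact (Nat.Prime 3)]
    (hGZ : ∀ (N : ℕ) [NeZero N] (W : WeierstrassCurve ℚ) (K : Type) [Field K] [NumberField K],
      gross_zagier N W K)
    (hKo : ∀ (N : ℕ) [NeZero N] (W : WeierstrassCurve ℚ) (K : Type) [Field K] [NumberField K],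
      kolyvagin N W K)
    (hGZK : rank_eq_analyticRank_of_analyticRank_le_one) (hmod : hasEntireLFunction_rat)
    (hnf : exists_isNewformOf) (hMaz : mazur_not_dvd_maninConstant_of_odd)
    (hPT : ∀ (K : Type) [Field K] [NumberField K], poitouTate_sum_localTatePairing_eq_zero K)
    (hEP : ∀ (K : Type) [Field K] [NumberField K] (v : HeightOneSpectrum (𝓞 K)),
      localEulerPoincareCharacteristic (v.adicCompletion K))
    (W : WeierstrassCurve ℚ) [W.IsElliptic] [W.IsGloballyMinimal] (hX : ClassX11b W 3)
    (hns : ¬ Surj W 3) (hSL : CornerStepLAt W) (hF2 : CornerTwinUpperAt W) :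
    Typed.MissingLowerBoundAt W 3 := by
  have hNS : integral_neronScaling_of_isGloballyMinimal :=
    integral_neronScaling_of_isGloballyMinimal_holds
  obtain ⟨hr, hp2, hmult, hirr⟩ := id hX
  haveI : NeZero (W.conductorNorm ℤ) := ⟨(W.conductorNorm_pos_holds).ne'⟩
  obtain ⟨K, _, _, Wd, _, _, Cd, ⟨hK, hodd, hlt, hHN, hH3, hLt, hWd⟩, qd, hqd, hvge⟩ := hF2 hX hns
  have hpd : ¬ (3 : ℤ) ∣ NumberField.discr K := not_dvd_discr_of_split hK Nat.prime_three hp2 hH3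
  have hμ : ¬ 3 ∣ Units.torsionOrder K := by
    haveI : IsTotallyComplex K := hK.2
    rw [Literature.NumberTheory.DiophantineGeometry.torsionOrder_eq_two_of_discr_lt hK.1 hlt]
    omega
  obtain ⟨Dt, H, ι, P, hP, hc⟩ :=
    exists_maninDatum_of_odd hnf hMaz hNS W 3 (W.conductorNorm ℤ) K rfl hp2 hmult hirr hK hHN
  have htam : padicValNat 3 Wd.tamagawaProduct = padicValNat 3 W.tamagawaProduct :=
    X2.padicValNat_tamagawaProduct_twist_of_heegner_of_odd W 3 hp2 K hK hodd hpd hHN Cd hWd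
  have hu : padicValRat 3 (Cd.u : ℚ) = 0 :=
    padicValRat_u_eq_zero_of_twist_minimal W 3 K hK hHN hmult Cd hWd
  exact missingLowerBoundAt_of_indexLowerBoundAt W 3 (W.conductorNorm ℤ) K Dt H ι P (hGZ _ W K)
    (hKo _ W K) hGZK hmod hK hHN hP hp2 hc hμ hr hLt Wd Cd hWd hu htam ⟨qd, hqd, hvge⟩
    (fun _ ↦ indexLowerBoundAt_of_cornerStepLAt hGZ hKo hmod hPT hEP W hX hns hSL (W.conductorNorm ℤ)
      K Dt H ι P rfl hK hodd hHN hLt hP hc)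

/-- **The squeeze** — `ord₃ #Ш(E) = ord₃ #Ш(E)_an` on the corner from (L), (U) on the Tamagawa cells, and the TWO half-twins
(F1′, F2′): replay of `missingPPartAt_of_corner_of_witness` with `CornerTwistWitnessAt` split into its two halves at two
fields. On `3 ∤ ∏c` the upper half of `E` comes from Matar–Nekovář at the F1′ field. `BSD₃` of no twin is used. -/
theorem missingPPartAt_of_corner_of_twoTwins [Fact (Nat.Prime 3)]
    (hGZ : ∀ (N : ℕ) [NeZero N] (W : WeierstrassCurve ℚ) (K : Type) [Field K] [NumberField K],
      gross_zagier N W K)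
    (hKo : ∀ (N : ℕ) [NeZero N] (W : WeierstrassCurve ℚ) (K : Type) [Field K] [NumberField K],
      kolyvagin N W K)
    (hGZK : rank_eq_analyticRank_of_analyticRank_le_one) (hmod : hasEntireLFunction_rat)
    (hnf : exists_isNewformOf) (hMaz : mazur_not_dvd_maninConstant_of_odd)
    (hPT : ∀ (K : Type) [Field K] [NumberField K], poitouTate_sum_localTatePairing_eq_zero K)
    (hEP : ∀ (K : Type) [Field K] [NumberField K] (v : HeightOneSpectrum (𝓞 K)),
      localEulerPoincareCharacteristic (v.adicCompletion K))
    (hMN : ∀ (N : ℕ) [NeZero N] (W : WeierstrassCurve ℚ) (K : Type) [Field K] [NumberField K],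
      MatarNekovar2019.thm03_padicValNat_card_sha_le_of_irreducible N W K)
    (W : WeierstrassCurve ℚ) [W.IsElliptic] [W.IsGloballyMinimal] (hX : ClassX11b W 3)
    (hns : ¬ Surj W 3)
    (hSL : CornerStepLAt W) (hF1 : CornerTwinLowerAt W) (hF2 : CornerTwinUpperAt W)
    (hU : 3 ∣ W.tamagawaProduct → Typed.MissingUpperBoundAt W 3) :
    Typed.MissingPPartAt W 3 := by
  refine Typed.missingPPartAt_of_lower_of_upper W 3
    (missingLowerBoundAt_of_cornerStepLAt_of_twinUpper hGZ hKo hGZK hmod hnf hMaz hPT hEP W hX hns hSL hF2) ?_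
  by_cases ht : 3 ∣ W.tamagawaProduct
  · exact hU ht
  · have hNS : integral_neronScaling_of_isGloballyMinimal :=
      integral_neronScaling_of_isGloballyMinimal_holds
    obtain ⟨hr, hp2, hmult, hirr⟩ := id hX
    haveI : NeZero (W.conductorNorm ℤ) := ⟨(W.conductorNorm_pos_holds).ne'⟩
    obtain ⟨K, _, _, Wd, _, _, Cd, ⟨hK, hodd, hlt, hHN, hH3, hLt, hWd⟩, qd, hqd, hvle⟩ := hF1 hX hns
    have hpd : ¬ (3 : ℤ) ∣ NumberField.discr K := not_dvd_discr_of_split hK Nat.prime_three hp2 hH3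
    have hμ : ¬ 3 ∣ Units.torsionOrder K := by
      haveI : IsTotallyComplex K := hK.2
      rw [Literature.NumberTheory.DiophantineGeometry.torsionOrder_eq_two_of_discr_lt hK.1 hlt]
      omega
    obtain ⟨Dt, H, ι, P, hP, hc⟩ :=
      exists_maninDatum_of_odd hnf hMaz hNS W 3 (W.conductorNorm ℤ) K rfl hp2 hmult hirr hK hHN
    have htam : padicValNat 3 Wd.tamagawaProduct = padicValNat 3 W.tamagawaProduct :=
      X2.padicValNat_tamagawaProduct_twist_of_heegner_of_odd W 3 hp2 K hK hodd hpd hHN Cd hWd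
    have hu : padicValRat 3 (Cd.u : ℚ) = 0 :=
      padicValRat_u_eq_zero_of_twist_minimal W 3 K hK hHN hmult Cd hWd
    have hD3 : NumberField.discr K ≠ -3 := by omega
    have hD4 : NumberField.discr K ≠ -4 := by omega
    exact missingUpperBoundAt_of_shaIndexBound W 3 (W.conductorNorm ℤ) K Dt H ι P (hGZ _ W K)
      (hKo _ W K) hGZK hmod hK hHN hP hp2 hc hμ hr hLt Wd Cd hWd hu htam ht ⟨qd, hqd, hvle⟩
      (fun _ hnt ↦ hMN _ W K hK hHN hD3 hD4 ⟨Dt, H, ι, hP⟩ hnt Nat.prime_three (by decide) hirr)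

/-- The (U)-conjunct of `CornerAtThree` feeds the squeeze through the F1′ replay (the shape `closes` consumes). -/
theorem missingUpperBoundAt_of_dvd_of_cornerUpperAt_of_twinLower [Fact (Nat.Prime 3)]
    (hGZ : ∀ (N : ℕ) [NeZero N] (W : WeierstrassCurve ℚ) (K : Type) [Field K] [NumberField K],
      gross_zagier N W K)
    (hKo : ∀ (N : ℕ) [NeZero N] (W : WeierstrassCurve ℚ) (K : Type) [Field K] [NumberField K],
      kolyvagin N W K)
    (hGZK : rank_eq_analyticRank_of_analyticRank_le_one) (hmod : hasEntireLFunction_rat)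
    (hnf : exists_isNewformOf) (hMaz : mazur_not_dvd_maninConstant_of_odd)
    (W : WeierstrassCurve ℚ) [W.IsElliptic] [W.IsGloballyMinimal] (hX : ClassX11b W 3)
    (hns : ¬ Surj W 3) (hU : CornerUpperAt W) (hF1 : CornerTwinLowerAt W) :
    3 ∣ W.tamagawaProduct → Typed.MissingUpperBoundAt W 3 :=
  fun ht ↦ missingUpperBoundAt_of_cornerUpperAt_of_twinLower hGZ hKo hGZK hmod hnf hMaz W hX hns ht hU hF1

end Summit.BirchSwinnertonDyer.BirchSwinnertonDyer.Theorems.CornerTwinHalves
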